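import Summits.BirchSwinnertonDyer.Rank1Residual.X11b.KolyvaginFrobeniusEigenparts
import Literature.NumberTheory.EllipticCurves.GeomReductionFrobeniusProofs
import Literature.NumberTheory.EllipticCurves.SerreOpenImageReductionInertiaProofs
import Literature.NumberTheory.EllipticCurves.HeegnerPointsKolyvaginConjugation
import Literature.NumberTheory.EllipticCurves.HeegnerPointsKolyvaginPairing
import Literature.NumberTheory.EllipticCurves.HeegnerPointsKolyvaginEulerSystem
import Literature.NumberTheory.EllipticCurves.FrobeniusTateModule
import Literature.NumberTheory.GaloisRepresentations.FrobeniusPlaces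
import Literature.NumberTheory.GaloisRepresentations.AbsIntegersEquiv
import Literature.NumberTheory.GaloisRepresentations.IntegralGaloisActionProofs
import Literature.NumberTheory.GaloisRepresentations.DecomposedGenericOfQuadratic
import HarnessLib

/-!
# McCallum's reduction datum at a Kolyvagin prime: the reduction `E(K̄) → Ẽ(𝔽̄_ℓ)` modulo a prime `𝔓 ∣ λ`

Cell `b2b-bsdres`, team x11b3 (N8/O2), sub-target S15 (viii) (lead ruling R7-62), File 1 of the
`h44` first cut. HONEST FRAMING (cell, verbatim): published theorems only; nothing here is
`p = 3`-specific; this is Kolyvagin-chain hygiene, NOT a discharge of `h44` — Gross's Prop. 3.7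
(Eichler–Shimura on `X₀(N)` mod `ℓ`) and the ring-class decomposition at `λ` stay hypotheses of the
consumer (`KolyvaginH44OfEulerCongruence`); nothing booked. Theorems only — no definition, no named
fact.

The tree proves McCallum 1991 Prop. 4.4 / Gross 1991 Prop. 6.2 (2) in order form
(`Literature.NumberTheory.EllipticCurves.zsmul_kolyvaginClass_mem_selmerLocalKer_iff_of_isKolyvaginPrime`,
`HeegnerPointsKolyvaginPrimaryRamifiedProofs` §5) modulo an abstract **reduction datum** `hdata` at
the primes `𝔓 ∣ λ` of `\bar ℤ_K`. This file constructs the reduction part of that datum from the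
tree's reduction of `ℚ̄`-points along a place (`geomReduction`, `GeomPointReduction`; Lang,
*Elliptic Functions* Ch. 9 §1; Silverman AEC VII.2.1):

* `geomReduction_conj_datum` — along ANY prime `𝔓₀ = δ • 𝔓pl ∣ ℓ` of `\bar ℤ` (primes above
  `ℓ` are `Γ_ℚ`-conjugate): `red = geomReduction ∘ δ⁻¹` is `I_{𝔓₀}`-invariant (tree
  `geomReduction_smul_of_mem_inertia`, AEC VII.4.1), carries every arithmetic Frobenius at `𝔓₀` to
  the `ℓ`-power Frobenius `φ` of `𝔽̄_ℓ` (tree `geomReduction_smul_of_isArithFrobAt`, Serre 1972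
  §1.11), is injective on `E[m]` for `ℓ ∤ m` (AEC VII.3.1(b)) and onto.
* `exists_torsion_lift` — `E[m] ≃ Ẽ[m]` for `ℓ ∤ m` by counting (`#E[m] = m² = #Ẽ[m]`,
  AEC III.6.4(b)); McCallum: *"the reduction map is injective on `E_{p^M}`"*.
* **`exists_reductionDatum`** — for a globally minimal elliptic `E = W/ℚ` with `ℓ ∤ Δ_W`,
  `Frob(ℓ) = Frob(∞)` on `E_p` (`FrobEqFrobInfty`, Gross (3.2)), `p` odd, `p ≠ ℓ`, `p ∣ ℓ + 1`,
  `p ∣ a_ℓ` (Gross (3.3)), the Weil pairing (the descent's named fact `exists_weilPairing`), a place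
  `v = λ` of a number field `K` which is the ONLY place above `ℓ` and has `q_λ = ℓ²` (inert), a
  prime `𝔓 ∣ λ` of `\bar ℤ_K`, and an arithmetic Frobenius `F` at `𝔓` fixing `E[n]` (`ℓ ∤ n ≠ 0`):
  there are `g ∈ Γ_K`, `red Q = geomReduction (θ⁻¹ (g⁻¹ Q))` (`θ : E(ℚ̄) ≃ E(K̄)`, tree
  `RatClosure.pointsEquiv`) and `φ = Frob_ℓ` with: `red` `I_𝔓`-invariant; `red ∘ F = φ² ∘ red`
  (`res F ≡ h²` modulo `I_{𝔓 ∩ \bar ℤ}` for a Frobenius `h` of `ℚ`, as `q_λ = ℓ²`); `red` injective on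
  `E[n]`; `φ² = 1` on `Ẽ[n]` (`F` fixes `E[n] ≃ Ẽ[n]`); every point of `Ẽ(𝔽̄_ℓ)` torsion;
  `(ℓ + 1) b = a_ℓ φ b` on `{φ² = 1}`; the `±`-eigen `p`-parts cyclic of exact orders
  `p^{v_p(ℓ+1∓a_ℓ)}` (Gross (3.4): `Frob(ℓ)` acts on `Ẽ[p] ≃ E[p]` as a conjugate of complex
  conjugation, which is not `±1` by the Weil pairing — tree `RatClosure.not_forall_smul_eq_sign`;
  then `frobenius_eigen_datum` of `KolyvaginFrobeniusEigenparts`). These are exactly the conjuncts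
  `hredI`, `hredF`, `hred`, `hBn`, `htors`, `hchar`, `hcyc` of `hdata` with `a = a_ℓ(W)`
  (`frobeniusTrace`); the remaining conjuncts (`F P_m = P_m`, `I_𝔓 ↠ ⟨σ_ℓ⟩`, the Euler root) are
  the ring-class / Prop. 3.7 inputs, not touched here.

## References
* [McCallumLMS1991] W. G. McCallum, *Kolyvagin's work on Shafarevich–Tate groups*, LMS LNS 153
  (1991), Prop. 4.4 and proof (held `book:editornd-l-functions-arithmetic`, PDF pp. 282–283).
* [GrossLMS1991] B. H. Gross, *Kolyvagin's work on modular elliptic curves*, ibid., §3 (3.2)–(3.4)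
  (PDF p. 216), Prop. 6.2 (2) (PDF pp. 222–223).
* [SilvermanAEC2009] J. H. Silverman, *The Arithmetic of Elliptic Curves*, 2nd ed., VII.2.1,
  VII.3.1(b), VII.4.1, III.6.4(b).
* [Serre1972] J.-P. Serre, Invent. Math. 15 (1972), §1.11.
-/

noncomputable section

open scoped Classical Pointwise
open WeierstrassCurve Field NumberField IsDedekindDomain
open Literature.NumberTheory.EllipticCurves Literature.NumberTheory.GaloisRepresentations
open Rat.HeightOneSpectrum

universe u

namespace Summit.BirchSwinnertonDyer.Rank1Residual.X11b.KolyvaginH44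

/-! ## §1. The reduction of `E(ℚ̄)` along an arbitrary prime `𝔓₀ ∣ ℓ` of `\bar ℤ` -/

section RatSide

variable {ℓ : ℕ} [Fact ℓ.Prime] {W : WeierstrassCurve ℚ} [W.IsGloballyMinimal] [W.IsElliptic]
  (hΔ : ¬ (ℓ : ℤ) ∣ minimalDiscriminantInt W)

/-- Conjugating into the inertia group of a translated prime: if `τ ∈ I_{δ • 𝔓}` then
`δ⁻¹ τ δ ∈ I_𝔓`. [folklore] -/
theorem conj_mem_inertia_of_mem_inertia_smul {Γ S : Type*} [Group Γ] [CommRing S]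
    [MulSemiringAction Γ S] {𝔓 : Ideal S} {δ τ : Γ} (hτ : τ ∈ (δ • 𝔓).inertia Γ) :
    δ⁻¹ * τ * δ ∈ 𝔓.inertia Γ := by
  intro x
  have h : τ • δ • x - δ • x ∈ δ • 𝔓 := hτ (δ • x)
  change (δ⁻¹ * τ * δ) • x - x ∈ 𝔓
  rw [Ideal.mem_pointwise_smul_iff_inv_smul_mem, smul_sub, inv_smul_smul, ← mul_smul,
    ← mul_smul] at h
  exact h

include hΔ in
/-- **The reduction map along any prime `𝔓₀ ∣ ℓ` of `\bar ℤ`.** For a globally minimal `E = W/ℚ`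
with `ℓ ∤ Δ_W`, the place `v₀ = (ℓ)` of `ℚ`, the prime `𝔓pl = 𝔪 ∩ \bar ℤ` of the chosen place
`placeOver ℓ` (tree `exists_ideal_placeOver`), a prime `𝔓₀ = δ • 𝔓pl` above `v₀` and the `ℓ`-power
Frobenius `φ ∈ Γ_{𝔽_ℓ}`: the additive map `red = geomReduction ∘ δ⁻¹ : E(ℚ̄) → Ẽ(𝔽̄_ℓ)` (the tree's
reduction along the place, precomposed with `δ⁻¹`) is invariant under the inertia group `I_{𝔓₀}`
(tree `geomReduction_smul_of_mem_inertia`), sends every arithmetic Frobenius at `𝔓₀` to `φ` (tree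
`geomReduction_smul_of_isArithFrobAt`, Serre 1972 §1.11), is injective on the `m`-torsion for
`ℓ ∤ m` (AEC VII.3.1(b), tree `eq_zero_of_smul_eq_zero_of_geomReduction_eq_zero`) and onto (tree
`geomReduction_surjective`). [cite: SilvermanAEC2009, Prop. VII.2.1, VII.3.1(b), VII.4.1]
[cite: Serre1972, §1.11] -/
theorem geomReduction_conj_datum {v₀ : HeightOneSpectrum (𝓞 ℚ)} (hv₀ : (primesEquiv v₀ : ℕ) = ℓ)
    {𝔓pl : Ideal (absIntegers (𝓞 ℚ) ℚ)}
    (hmem : ∀ x : absIntegers (𝓞 ℚ) ℚ, x ∈ 𝔓pl ↔ (x : AlgebraicClosure ℚ) ∈ (placeOver ℓ).nonunits)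
    (h𝔓pl : 𝔓pl ∈ v₀.primesAbove) {𝔓₀ : Ideal (absIntegers (𝓞 ℚ) ℚ)}
    {δ : absoluteGaloisGroup ℚ} (hδ : δ • 𝔓pl = 𝔓₀)
    {φ : absoluteGaloisGroup (ZMod ℓ)} (hφ : ∀ x : AlgebraicClosure (ZMod ℓ), φ • x = x ^ ℓ) :
    (∀ τ ∈ 𝔓₀.inertia (absoluteGaloisGroup ℚ), ∀ P,
      ((geomReduction hΔ).comp (DistribSMul.toAddMonoidHom W.geomPoints δ⁻¹)) (τ • P) =
        ((geomReduction hΔ).comp (DistribSMul.toAddMonoidHom W.geomPoints δ⁻¹)) P) ∧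
    (∀ σ : absoluteGaloisGroup ℚ, IsArithFrobAt (𝓞 ℚ) σ 𝔓₀ → ∀ P,
      ((geomReduction hΔ).comp (DistribSMul.toAddMonoidHom W.geomPoints δ⁻¹)) (σ • P) =
        φ • ((geomReduction hΔ).comp (DistribSMul.toAddMonoidHom W.geomPoints δ⁻¹)) P) ∧
    (∀ m : ℕ, ¬ ℓ ∣ m → ∀ P, m • P = 0 →
      ((geomReduction hΔ).comp (DistribSMul.toAddMonoidHom W.geomPoints δ⁻¹)) P = 0 → P = 0) ∧
    Function.Surjective ((geomReduction hΔ).comp (DistribSMul.toAddMonoidHom W.geomPoints δ⁻¹)) := by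
  set red : W.geomPoints →+ (reductionModPrime W ℓ).geomPoints :=
    (geomReduction hΔ).comp (DistribSMul.toAddMonoidHom W.geomPoints δ⁻¹) with hred
  have hred_apply : ∀ P, red P = geomReduction hΔ (δ⁻¹ • P) := fun P ↦ rfl
  refine ⟨?_, ?_, ?_, ?_⟩
  · intro τ hτ P
    rw [← hδ] at hτ
    have hτ' := conj_mem_inertia_of_mem_inertia_smul hτ
    rw [hred_apply, hred_apply, show δ⁻¹ • τ • P = (δ⁻¹ * τ * δ) • (δ⁻¹ • P) by
      rw [← mul_smul, ← mul_smul, mul_assoc, mul_assoc, mul_inv_cancel, mul_one]]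
    exact geomReduction_smul_of_mem_inertia hΔ hmem hτ' _
  · intro σ hσ P
    have hσ' : IsArithFrobAt (𝓞 ℚ) (δ⁻¹ * σ * δ⁻¹⁻¹) (δ⁻¹ • 𝔓₀) := hσ.conj δ⁻¹
    rw [inv_inv, ← hδ, inv_smul_smul] at hσ'
    rw [hred_apply, hred_apply, show δ⁻¹ • σ • P = (δ⁻¹ * σ * δ) • (δ⁻¹ • P) by
      rw [← mul_smul, ← mul_smul, mul_assoc, mul_assoc, mul_inv_cancel, mul_one]]
    exact geomReduction_smul_of_isArithFrobAt hΔ hmem hv₀ h𝔓pl hσ' hφ _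
  · intro m hm P hmP h0
    rw [hred_apply] at h0
    have hmP' : m • (δ⁻¹ • P) = 0 := by
      rw [smul_comm m δ⁻¹ P, hmP, smul_zero]
    have := eq_zero_of_smul_eq_zero_of_geomReduction_eq_zero hΔ hm hmP' h0
    exact (smul_eq_zero_iff_eq δ⁻¹).mp this
  · intro b
    obtain ⟨P, hP⟩ := geomReduction_surjective hΔ b
    exact ⟨δ • P, by rw [hred_apply, inv_smul_smul, hP]⟩

end RatSide

/-! ## §2. Transport to `E(K̄)` and the Frobenius at an inert prime -/

section KSide

variable {K : Type u} [Field K] [NumberField K]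
  {ℓ : ℕ} [hℓ : Fact ℓ.Prime] (W : WeierstrassCurve ℚ) [W.IsGloballyMinimal] [W.IsElliptic]
  (hΔ : ¬ (ℓ : ℤ) ∣ minimalDiscriminantInt W)

omit hℓ [W.IsGloballyMinimal] [W.IsElliptic] in
/-- `Γ_K`-equivariance of `E(K̄) ≃ E(ℚ̄)` (inverse of the tree's `RatClosure.pointsEquiv_smul`).
[folklore] -/
theorem pointsEquiv_symm_smul (g : absoluteGaloisGroup K) (Q : geomPoints (W.baseChange K)) :
    (RatClosure.pointsEquiv (K := K) W).symm (g • Q) =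
      absGaloisRestrict ℚ K g • (RatClosure.pointsEquiv (K := K) W).symm Q := by
  apply (RatClosure.pointsEquiv (K := K) W).injective
  rw [AddEquiv.apply_symm_apply, RatClosure.pointsEquiv_smul, AddEquiv.apply_symm_apply]

omit hℓ in
/-- The place `v₀ = (ℓ)` of `ℚ`. [folklore] -/
theorem exists_ratPlace (ℓ : ℕ) [Fact ℓ.Prime] :
    ∃ v₀ : HeightOneSpectrum (𝓞 ℚ), (primesEquiv v₀ : ℕ) = ℓ ∧ (ℓ : 𝓞 ℚ) ∈ v₀.asIdeal := by
  set v₀ : HeightOneSpectrum (𝓞 ℚ) := primesEquiv.symm ⟨ℓ, Fact.out⟩ with hv₀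
  have h1 : (primesEquiv v₀ : ℕ) = ℓ := by rw [hv₀, Equiv.apply_symm_apply]
  refine ⟨v₀, h1, (Rat.natCast_mem_asIdeal_iff v₀).mpr ?_⟩
  change (primesEquiv v₀ : ℕ) ∣ ℓ
  rw [h1]

include hΔ in
/-- **`E[m] ≃ Ẽ[m]` under a reduction map injective on `E[m]`** (`ℓ ∤ m`): counting, `#E[m] = m² =
#Ẽ[m]` (tree `card_torsionPoints_eq_sq_holds` on both sides, AEC III.6.4(b)); so every `m`-torsion
point of `Ẽ(𝔽̄_ℓ)` lifts to an `m`-torsion point of `E(ℚ̄)` (McCallum 1991, proof of Prop. 4.4: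
*"`E_{p^M}(K̄_λ) = E_{p^M}(K_λ)` … the reduction map is injective on `E_{p^M}`"*).
[cite: SilvermanAEC2009, Prop. VII.3.1(b), Cor. III.6.4(b)] -/
theorem exists_torsion_lift {red : W.geomPoints →+ (reductionModPrime W ℓ).geomPoints}
    (hinj : ∀ m : ℕ, ¬ ℓ ∣ m → ∀ P, m • P = 0 → red P = 0 → P = 0)
    {m : ℕ} (hm : ¬ ℓ ∣ m) (hm0 : m ≠ 0) (b : (reductionModPrime W ℓ).geomPoints)
    (hb : (m : ℤ) • b = 0) : ∃ P : W.geomPoints, (m : ℤ) • P = 0 ∧ red P = b := by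
  haveI : (reductionModPrime W ℓ).IsElliptic := isElliptic_reductionModPrime W hΔ
  have hmQ : (m : ℚ) ≠ 0 := by exact_mod_cast hm0
  have hmF : (m : ZMod ℓ) ≠ 0 := by rw [ne_eq, ZMod.natCast_eq_zero_iff]; exact hm
  have hcE := natCard_torsion_eq_sq W hmQ
  have hcB := natCard_torsion_eq_sq (reductionModPrime W ℓ) hmF
  haveI : Finite {b : (reductionModPrime W ℓ).geomPoints // (m : ℤ) • b = 0} :=
    Nat.finite_of_card_ne_zero (by rw [hcB]; exact pow_ne_zero 2 hm0)
  set f : {P : W.geomPoints // (m : ℤ) • P = 0} →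
      {b : (reductionModPrime W ℓ).geomPoints // (m : ℤ) • b = 0} :=
    fun P ↦ ⟨red P.1, by rw [← map_zsmul, P.2, map_zero]⟩ with hf
  have hfinj : Function.Injective f := by
    rintro ⟨P, hP⟩ ⟨P', hP'⟩ h
    have h' : red P = red P' := congrArg Subtype.val h
    apply Subtype.ext
    rw [← sub_eq_zero]
    refine hinj m hm _ ?_ (by rw [map_sub, h', sub_self])
    rw [← natCast_zsmul, smul_sub, hP, hP', sub_zero]
  have hbij := Function.Injective.bijective_of_nat_card_le hfinj (by rw [hcE, hcB])
  obtain ⟨⟨P, hP⟩, hPb⟩ := hbij.2 ⟨b, hb⟩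
  exact ⟨P, hP, congrArg Subtype.val hPb⟩

include hΔ in
/-- **McCallum's reduction datum at a Kolyvagin prime** — the conjuncts of `hdata` of the tree's
`zsmul_kolyvaginClass_mem_selmerLocalKer_iff_of_isKolyvaginPrime`
(`HeegnerPointsKolyvaginPrimaryRamifiedProofs`, §5) that concern the REDUCTION and the FINITE FIELD,
proved: for a globally minimal elliptic `E = W/ℚ`, a prime `ℓ ∤ Δ_W` with `Frob(ℓ) = Frob(∞)` on
`E_p` (`FrobEqFrobInfty W K p ℓ`, Gross (3.2)), `p` odd, `p ≠ ℓ`, `p ∣ ℓ + 1`, `p ∣ a_ℓ` (Gross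
(3.3)), the Weil pairing (named fact `exists_weilPairing`, as in the descent), a place `v = λ` of the
number field `K` above `ℓ` with residue field of `ℓ²` elements (`λ` inert), a prime `𝔓 ∣ λ` of
`\bar ℤ_K`, and an arithmetic Frobenius `F` at `𝔓` fixing `E[n]` (`ℓ ∤ n ≠ 0`): with
`B = Ẽ(𝔽̄_ℓ)` (`(reductionModPrime W ℓ).geomPoints`), `red : E(K̄) → B` (§1 transported along
`E(K̄) ≃ E(ℚ̄)`, tree `RatClosure.pointsEquiv`) and `φ = Frob_ℓ`:
`red` is `I_𝔓`-invariant; `red ∘ F = φ² ∘ red` (`F ≡ h²` modulo `I_{𝔓 ∩ \bar ℤ}` for a Frobenius `h`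
of `ℚ` at `𝔓 ∩ \bar ℤ`, since `q_λ = ℓ²`); `red` is injective on `E[n]`; `φ² = 1` on `B[n]`
(`E[n] ≃ B[n]`, `F` fixes `E[n]`); every point of `B` is torsion; `(ℓ+1) b = a_ℓ φ b` on
`{φ² = 1}`; and the `±`-eigen `p`-parts are cyclic of exact orders `p^{v_p(ℓ+1∓a_ℓ)}` (Gross (3.4)
from `Frob(ℓ) = c₀` on `E[p]` and the Weil pairing, tree `RatClosure.not_forall_smul_eq_sign`, via
`frobenius_eigen_datum`). What is NOT here (hypotheses of the consumer): `F P_m = P_m`, the inertia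
structure `I_𝔓 ↠ ⟨σ_ℓ⟩` (ring class fields) and the Euler-system root (Gross Prop. 3.7).
[cite: McCallumLMS1991, Prop. 4.4 (proof)] [cite: GrossLMS1991, §3 (3.2)–(3.4), Prop. 6.2 (2)]
[cite: SilvermanAEC2009, Prop. VII.2.1, VII.3.1(b), VII.4.1] -/
theorem exists_reductionDatum {p : ℕ} [hp : Fact p.Prime] (hp2 : p ≠ 2) (hpℓ : p ≠ ℓ)
    (hW : W.exists_weilPairing p) (hpl : p ∣ ℓ + 1) (hpa : (p : ℤ) ∣ W.frobeniusTrace ℓ)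
    (h32 : FrobEqFrobInfty W K p ℓ)
    {φ₀ : absoluteGaloisGroup (ZMod ℓ)} (hφ : ∀ x : AlgebraicClosure (ZMod ℓ), φ₀ • x = x ^ ℓ)
    {v : HeightOneSpectrum (𝓞 K)} (hv : (ℓ : 𝓞 K) ∈ v.asIdeal)
    (huniq : ∀ w : HeightOneSpectrum (𝓞 K), (ℓ : 𝓞 K) ∈ w.asIdeal → w = v)
    (hres : v.residueCard = ℓ ^ 2)
    {𝔓 : Ideal (absIntegers (𝓞 K) K)} (h𝔓 : 𝔓 ∈ v.primesAbove)
    {n : ℕ} (hn : ¬ ℓ ∣ n) (hn0 : n ≠ 0) {F : absoluteGaloisGroup K}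
    (hF : IsArithFrobAt (𝓞 K) F 𝔓) (hFfix : F ∈ torsionFixing (W.baseChange K) (n : ℤ)) :
    ∃ (g : absoluteGaloisGroup K)
      (red : geomPoints (W.baseChange K) →+ (reductionModPrime W ℓ).geomPoints)
      (φ : (reductionModPrime W ℓ).geomPoints →+ (reductionModPrime W ℓ).geomPoints),
      (∀ x, red x = geomReduction hΔ ((RatClosure.pointsEquiv (K := K) W).symm (g⁻¹ • x))) ∧
      (∀ b, φ b = φ₀ • b) ∧
      (∀ τ ∈ 𝔓.inertia (absoluteGaloisGroup K), ∀ x, red (τ • x) = red x) ∧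
      (∀ x, red (F • x) = φ (φ (red x))) ∧
      (∀ x, (n : ℤ) • x = 0 → red x = 0 → x = 0) ∧
      (∀ b, (n : ℤ) • b = 0 → φ (φ b) = b) ∧
      (∀ b, φ (φ b) = b → IsOfFinAddOrder b) ∧
      (∀ b, φ (φ b) = b → ((ℓ + 1 : ℕ) : ℤ) • b = W.frobeniusTrace ℓ • φ b) ∧
      (∀ s : ℤ, s = 1 ∨ s = -1 → ∃ (g : (reductionModPrime W ℓ).geomPoints) (e : ℕ),
        φ g = s • g ∧ addOrderOf g = p ^ e ∧
        (p : ℤ) ^ e ∣ ((ℓ + 1 : ℕ) : ℤ) - s * W.frobeniusTrace ℓ ∧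
        ¬ (p : ℤ) ^ (e + 1) ∣ ((ℓ + 1 : ℕ) : ℤ) - s * W.frobeniusTrace ℓ ∧
        ∀ c, φ c = s • c → (∃ k : ℕ, ((p : ℤ) ^ k) • c = 0) → ∃ i : ℤ, c = i • g) := by
  haveI : (reductionModPrime W ℓ).IsElliptic := isElliptic_reductionModPrime W hΔ
  set θ := RatClosure.pointsEquiv (K := K) W with hθ
  -- the place `v₀ = (ℓ)` of `ℚ`, the prime `𝔓₀ = 𝔓 ∩ \bar ℤ`, the prime `𝔓pl` of the place
  obtain ⟨v₀, hv₀, hℓv₀⟩ := exists_ratPlace ℓ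
  haveI := v.isPrime
  have hw : v.asIdeal.under (𝓞 ℚ) = v₀.asIdeal :=
    Rat.under_eq_asIdeal_of_natCast_mem hℓ.out hℓv₀ hv
  set 𝔓₀ : Ideal (absIntegers (𝓞 ℚ) ℚ) := 𝔓.comap (absIntegersMap ℚ K) with h𝔓₀def
  have h𝔓₀ : 𝔓₀ ∈ v₀.primesAbove := comap_absIntegersMap_mem_primesAbove hw h𝔓
  obtain ⟨𝔓pl, hmem, h𝔓pl⟩ := exists_ideal_placeOver ℓ hv₀
  -- a `g ∈ Γ_K` with `res g • 𝔓pl = 𝔓₀` (transitivity of `Γ_K` on the primes above the inert `λ`)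
  obtain ⟨𝔔, w, h𝔔c, hwv₀, h𝔔w⟩ := exists_place_comap_eq_smul (M := K) h𝔓pl 1
  rw [one_smul] at h𝔔c
  have hwv : w = v := by
    refine huniq w ?_
    haveI := w.isPrime
    have : (ℓ : 𝓞 ℚ) ∈ w.asIdeal.under (𝓞 ℚ) := by rw [hwv₀]; exact hℓv₀
    rw [Ideal.under_def, Ideal.mem_comap, map_natCast] at this
    exact this
  subst hwv
  obtain ⟨g, hg⟩ := HeightOneSpectrum.exists_smul_eq_of_mem_primesAbove_holds h𝔔w h𝔓
  have hδ : absGaloisRestrict ℚ K g • 𝔓pl = 𝔓₀ := by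
    rw [← h𝔔c, ← comap_absIntegersMap_smul, hg]
  -- the reduction along `𝔓₀`
  obtain ⟨hI, hFr, hinj, -⟩ := geomReduction_conj_datum hΔ hv₀ hmem h𝔓pl hδ hφ
  set red₀ : W.geomPoints →+ (reductionModPrime W ℓ).geomPoints :=
    (geomReduction hΔ).comp (DistribSMul.toAddMonoidHom W.geomPoints (absGaloisRestrict ℚ K g)⁻¹)
    with hred₀def
  have hred₀ : ∀ P, red₀ P = geomReduction hΔ ((absGaloisRestrict ℚ K g)⁻¹ • P) := fun P ↦ rfl
  set red : geomPoints (W.baseChange K) →+ (reductionModPrime W ℓ).geomPoints :=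
    red₀.comp θ.symm.toAddMonoidHom with hreddef
  have hred : ∀ Q, red Q = red₀ (θ.symm Q) := fun Q ↦ rfl
  set Φ : (reductionModPrime W ℓ).geomPoints →+ (reductionModPrime W ℓ).geomPoints :=
    DistribSMul.toAddMonoidHom _ φ₀ with hΦdef
  have hΦ : ∀ b, Φ b = φ₀ • b := fun b ↦ rfl
  -- ### `red ∘ F = φ² ∘ red`
  have hredF : ∀ x, red (F • x) = Φ (Φ (red x)) := by
    have hF' : ∀ x : absIntegers (𝓞 ℚ) ℚ,
        absGaloisRestrict ℚ K F • x - x ^ (ℓ ^ 2) ∈ 𝔓₀ := by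
      rw [forall_smul_sub_pow_mem_comap_iff ℚ K 𝔓 F (ℓ ^ 2), ← hres]
      exact (HeightOneSpectrum.isArithFrobAt_iff_of_mem_primesAbove h𝔓 F).mp hF
    obtain ⟨h', hh'⟩ := HeightOneSpectrum.exists_isArithFrobAt_of_mem_primesAbove_holds h𝔓₀
    have hq : v₀.residueCard = ℓ := by
      rw [Rat.residueCard_eq_natGenerator]; exact hv₀
    have hpow : ∀ x : absIntegers (𝓞 ℚ) ℚ, h' ^ 2 • x - x ^ (ℓ ^ 2) ∈ 𝔓₀ := fun x ↦ by
      have := smul_pow_sub_pow_mem_of_isArithFrobAt h𝔓₀ hh' 2 x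
      rwa [hq] at this
    set ι : absoluteGaloisGroup ℚ := absGaloisRestrict ℚ K F * (h' ^ 2)⁻¹ with hι
    have hιI : ι ∈ 𝔓₀.inertia (absoluteGaloisGroup ℚ) := by
      intro x
      change ι • x - x ∈ 𝔓₀
      set y := (h' ^ 2)⁻¹ • x with hy
      have hx : x = h' ^ 2 • y := by rw [hy, smul_inv_smul]
      have h1 : ι • x = absGaloisRestrict ℚ K F • y := by rw [hι, mul_smul]
      rw [h1, hx]
      have := sub_mem (hF' y) (hpow y)
      rwa [sub_sub_sub_cancel_right] at this
    have hιh : ι * h' ^ 2 = absGaloisRestrict ℚ K F := by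
      rw [hι, mul_assoc, inv_mul_cancel, mul_one]
    intro x
    rw [hred, hred, pointsEquiv_symm_smul, ← hιh, mul_smul, hI ι hιI, pow_two, mul_smul,
      hFr h' hh', hFr h' hh', hΦ, hΦ]
  -- ### an arithmetic Frobenius at `𝔓₀` acting on `E[p]` as a conjugate of complex conjugation
  obtain ⟨v', 𝔓h, h, c₀, hℓv', h𝔓h, hh, hc₀, hE, -⟩ := h32
  have hv' : v' = v₀ := Rat.natGenerator_injective
    ((Rat.natGenerator_eq_of_natCast_mem hℓ.out hℓv').trans
      (Rat.natGenerator_eq_of_natCast_mem hℓ.out hℓv₀).symm)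
  subst hv'
  obtain ⟨δ', hδ'⟩ := HeightOneSpectrum.exists_smul_eq_of_mem_primesAbove_holds h𝔓h h𝔓₀
  set gc : absoluteGaloisGroup ℚ := δ' * h * δ'⁻¹ with hgdef
  have hgc : IsArithFrobAt (𝓞 ℚ) gc 𝔓₀ := by rw [← hδ']; exact hh.conj δ'
  have hpQ : (p : ℚ) ≠ 0 := by exact_mod_cast hp.out.ne_zero
  have hgT : ∀ P : W.geomPoints, (p : ℤ) • P = 0 → gc • P = δ' • c₀ • δ'⁻¹ • P := by
    intro P hP
    have hP' : δ'⁻¹ • P ∈ geomTorsion W p := by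
      rw [mem_geomTorsion_iff, smul_comm, hP, smul_zero]
    have := congrArg Subtype.val (hE ⟨δ'⁻¹ • P, hP'⟩)
    simp only [Literature.NumberTheory.EllipticCurves.AddSubgroup.torsionBy.coe_smul] at this
    rw [hgdef, mul_smul, mul_smul, this]
  have hgg : ∀ P : W.geomPoints, (p : ℤ) • P = 0 → gc • gc • P = P := by
    intro P hP
    have hP1 : (p : ℤ) • (gc • P) = 0 := by rw [smul_comm, hP, smul_zero]
    rw [hgT _ hP1, hgT _ hP, inv_smul_smul, ← mul_smul c₀ c₀, ← pow_two, hc₀.sq_eq_one, one_smul,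
      smul_inv_smul]
  have hinv : ∀ b : (reductionModPrime W ℓ).geomPoints, (p : ℤ) • b = 0 → φ₀ • φ₀ • b = b := by
    intro b hb
    obtain ⟨P, hP, rfl⟩ := exists_torsion_lift W hΔ hinj (hpℓ.symm ∘ fun h ↦
      ((Nat.prime_dvd_prime_iff_eq hℓ.out hp.out).mp h)) hp.out.ne_zero b hb
    rw [← hFr gc hgc, ← hFr gc hgc, hgg P hP]
  have hns : ∀ s : ℤ, s = 1 ∨ s = -1 →
      ¬ ∀ b : (reductionModPrime W ℓ).geomPoints, (p : ℤ) • b = 0 → φ₀ • b = s • b := by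
    intro s hs hall
    apply RatClosure.not_forall_smul_eq_sign W hc₀ hW hp2 hs
    intro Q
    apply Subtype.ext
    simp only [Literature.NumberTheory.EllipticCurves.AddSubgroup.torsionBy.coe_smul]
    have hQ : (p : ℤ) • (Q : W.geomPoints) = 0 := (mem_geomTorsion_iff W p _).mp Q.2
    set P : W.geomPoints := δ' • (Q : W.geomPoints) with hPdef
    have hP : (p : ℤ) • P = 0 := by rw [hPdef, smul_comm, hQ, smul_zero]
    have hred0 : red₀ (gc • P - s • P) = 0 := by
      rw [map_sub, hFr gc hgc, map_zsmul, hall _ (by rw [← map_zsmul, hP, map_zero]), sub_self]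
    have htor : p • (gc • P - s • P) = 0 := by
      rw [← natCast_zsmul, smul_sub, smul_comm, hP, smul_zero, zero_sub, neg_eq_zero, smul_comm,
        hP, smul_zero]
    have hgP := sub_eq_zero.mp (hinj p (hpℓ.symm ∘ fun h ↦
      ((Nat.prime_dvd_prime_iff_eq hℓ.out hp.out).mp h)) _ htor hred0)
    rw [hgT P hP, hPdef, inv_smul_smul, smul_comm s δ'] at hgP
    exact MulAction.injective δ' hgP
  -- ### the finite-field datum
  have ha : W.frobeniusTrace ℓ = (ℓ : ℤ) + 1 - Nat.card (reductionModPrime W ℓ).toAffine.Point :=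
    frobeniusTrace_eq_sub_natCard_reductionModPrime W ℓ
  obtain ⟨htors, hchar, hcyc⟩ :=
    frobenius_eigen_datum (reductionModPrime W ℓ) hφ hp2 hpℓ ha hpl hpa hinv hns
  refine ⟨g, red, Φ, fun x ↦ ?_, fun b ↦ rfl, ?_, hredF, ?_, ?_, fun b hb ↦ htors b hb,
    fun b hb ↦ hchar b hb, ?_⟩
  · rw [hred, hred₀, pointsEquiv_symm_smul, map_inv]
  · -- inertia
    intro τ hτ x
    rw [hred, hred, pointsEquiv_symm_smul]
    exact hI _ (absGaloisRestrict_mem_inertia_comap ℚ K hτ) _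
  · -- injective on `E[n]`
    intro x hx h0
    rw [hred] at h0
    have hx' : n • θ.symm x = 0 := by rw [← natCast_zsmul, ← map_zsmul, hx, map_zero]
    have := hinj n hn _ hx' h0
    rw [← θ.symm.map_eq_zero_iff]
    exact this
  · -- `φ² = 1` on `B[n]`
    intro b hb
    obtain ⟨P₀, hP₀, rfl⟩ := exists_torsion_lift W hΔ hinj hn hn0 b hb
    set Q : geomPoints (W.baseChange K) := θ P₀ with hQdef
    have hQn : Q ∈ geomTorsion (W.baseChange K) (n : ℤ) := by
      rw [mem_geomTorsion_iff, hQdef, ← map_zsmul, hP₀, map_zero]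
    have hFQ : F • Q = Q :=
      congrArg Subtype.val (((mem_torsionFixing_iff (W.baseChange K) (n : ℤ)).mp hFfix) ⟨Q, hQn⟩)
    have hQred : red Q = red₀ P₀ := by rw [hred, hQdef, AddEquiv.symm_apply_apply]
    rw [← hQred, ← hredF, hFQ]
  · intro s hs
    obtain ⟨g₁, e, hg₁, hord, hdvd, hndvd, hgen⟩ := hcyc s hs
    exact ⟨g₁, e, hg₁, hord, hdvd, hndvd, hgen⟩

end KSide

end Summit.BirchSwinnertonDyer.Rank1Residual.X11b.KolyvaginH44

end
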